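import Summits.Parity.BatemanHorn.Theses.OneSidedDegreeLadder
import Summits.Parity.BatemanHorn.Theses.OddParityLadder
import Summits.Parity.BatemanHorn.Theses.DegreeExcessLadder
import Literature.NumberTheory.Sieve.IwaniecAlmostPrimes
import HarnessLib

/-!
# BC3 birth skeleton — crux `ChenQuad` (stmt-Parity-26565) of route `OneSidedDegreeLadder`
(Parity / BatemanHorn; child of the declared residual `LowerNonlinear`, node AlmostPrimeExcessLadder, grade (θ,e) = (1,1))

Line-writer seat `linewriter-parity-certcluster-1` g0 (2026-08-31), the ONE NEW line asked for by the decomp-parity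
writer g19 (ladder-directors REQUESTS l.65717, item 8): «2 stubs = [sieve stub, ATTACKABLE/print: P₂ lower bound for
every irreducible quadratic Bateman–Horn cell with an explicit constant θ₂(ϑ)·C(q)/2 from level ϑ — rung (1/77) is the
tree's named fact `Iwaniec1978.theorem_quadratic`] + [level stub, IDEA-NEEDED: level ϑ for q(n) large enough that
θ₂(ϑ) ≥ 1 − ε; barriers WeightedSieveLimit / LinearSieveOptimality placed on it]».

LINE «LevelDetector».  `ChenQuad` (for every quadratic BH polynomial `q`: `#{n ≤ x : q(n) > 1, Ω(q(n)) ≤ 2} ≥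
(1−ε)·C(q)/2·x/log x` eventually)  ⇐  `stub_bilinearLevel74` ∧ `stub_sieveDetector`:

* `stub_sieveDetector` (print-grade, L; the INSTRUMENT θ₂(ϑ) made a theorem): for `4/3 ≤ ϑ ≤ 2`, a BILINEAR level
  `x^ϑ` for `𝒜_q = {q(n) : n ≤ x}` (Iwaniec's form of the remainder, `HasBilinearLevel q ϑ` below) gives
  `#{n ≤ x : q(n) > 1, Ω(q(n)) ≤ 2} ≥ (θ₂(ϑ) − ε)·C(q)/2·x/log x`, `θ₂(ϑ) = 4·log(3ϑ/2 − 1)/ϑ` — the UNWEIGHTED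
  cube-root detector: sieve `𝒜_q` by all primes `< z_q(x) = (|lead q|+2)·x^{2/3}` (then `z³ > q(n)`, so a survivor is
  a `P₂`), lower-bound LINEAR sieve with bilinear remainder [tree, PROVED: `Iwaniec1978.lemma2_bilinearSieve`
  (`lemma2_bilinearSieve_holds`), Iwaniec, Acta Arith. 37 (1980) Thm 1] at `s = log(MN)/log z → 3ϑ/2 ∈ [2, 3]`,
  `f(s) = 2e^γ log(s−1)/s`, and Mertens for `ρ_q`: `V(z) ~ C(q)·e^{−γ}/log z` [tree:
  `BatemanHornMertensProduct.tendsto_log_mul_prod_one_sub_rootCount_single`; general-quadratic Mertens I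
  `IwaniecAlmostPrimesQuadraticMertens.rhoMertensStrongG`]; so `V(z)·x·f(s) ~ (C(q)/2)(x/log x)·4 log(3ϑ/2−1)/ϑ`.
  At `ϑ = 4/3` the constant is `0` (trivially true); `θ₂(ϑ*) = 1` at `ϑ* ≈ 1.678`; `θ₂(7/4) = (16/7)·log(13/8) ≈ 1.1097`.
* `stub_bilinearLevel74` (IDEA-NEEDED, the level content of `ChenQuad`): every quadratic BH polynomial has bilinear
  level `x^{7/4}`: for every `ε > 0` SOME shapes `M(x), N(x) > 1` with `x^{7/4} ≤ MN ≤ x²` make every `1`-bounded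
  bilinear form `Σ_{m<M} Σ_{n<N} [mn ∣ P(z_q(x))] a_m b_n r_q(x; mn)` at most `ε·x/log x` eventually, where
  `r_q(x; d) = #{n ≤ x : d ∣ q(n)} − ρ_q(d)/d·(x+1)`.  Known: `16/15` (Iwaniec 1978, for n²+1; Lemke Oliver 2012 for
  general q), `≈ 1.218` (de la Bretèche–Drappeau, doi:10.4171/jems/951), `1.279`-type Type-I/II information for n²+1
  (Merikoski, arXiv:1908.08816).  WHY BILINEAR and `∃ shapes` (design, checked here): the plain level
  `Σ_{d ≤ x^ϑ} |r_q(x; d)|` is FALSE for every `ϑ > 1` (for `d > x` each `|r_d| ≍ ρ(d)x/d` individually, summing to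
  `≍ x·log(D/x) ≫ x/log x`), so only cancellation inside bilinear forms with both `M, N` away from `1` can hold; the
  `∃ M N` lets the level-prover choose the shape it can prove, and Iwaniec's theorem accepts ANY one factorisation
  `D = MN` (no well-factorability needed).  Why it might fail: a Maier-matrix / Friedlander–Granville irregularity
  for `q(n)` in progressions could cap bilinear levels at `x^{2}(log x)^{−A}` — far above `7/4`; nothing known caps `7/4`.
* Composition `ChenQuad_of` (kernel-checked): `θ₂(7/4) = (16/7)·log(13/8) > 1` (`log 2 > 0.6931`, `log(16/13) ≤ 3/13`),
  so the sieve stub at `ϑ = 7/4` with slack `θ₂(7/4) − (1−ε) > 0` is `ChenQuad` verbatim.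

Neither stub restates the crux or the summit: the sieve stub is a conditional theorem of print (its hypothesis is not in
the tree for any `ϑ ≥ 4/3`), the level stub is a distribution statement in progressions that Bateman–Horn does not give
and that does not give `ChenQuad` without the sieve.  Barriers: WeightedSieveLimit (`Λ_R ≤ R`) / LinearSieveOptimality
(`f(s)` optimal at fixed level) are INSIDE the sieve stub as typed — they are exactly why the level stub must carry
`ϑ ≥ ϑ* ≈ 1.678` for the unweighted detector (a weighted detector — Richert/Greaves/DHG weights — lowers the needed `ϑ`;
that sharpening is a second line replacing `stub_sieveDetector`, not attempted here); SelbergParity does not bite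
(`P₂` counts both parities; node theorem `bombieri_asymptotic_sieve_holds`).  Rung below the line: (1/77, bilinear level
16/15, Richert weights) = `Iwaniec1978.theorem_quadratic` / `card_P2_lower_holds` (tree).
-/

noncomputable section

open Filter Finset
open Literature.NumberTheory.Sieve

namespace Summit.Parity.BatemanHorn.Cruxes.ChenQuad.Birth

/-! ### Vocabulary: congruence sums, remainders, the detector's sifting limit, bilinear remainder forms -/

/-- `ρ_q(d) = #{n mod d : d ∣ q(n)}` (the tree's `polyRootCountMod` of the one-member system `![q]`). -/
def rhoQ (q : Polynomial ℤ) (d : ℕ) : ℕ := polyRootCountMod ![q] d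

/-- `A_d(x) = #{n ≤ x : d ∣ q(n)}` over `n ∈ {0, …, x}` (the crux's range). -/
def congrQ (q : Polynomial ℤ) (x d : ℕ) : ℕ :=
  ((Finset.range (x + 1)).filter fun n : ℕ => (d : ℤ) ∣ q.eval (n : ℤ)).card

/-- `r_q(x; d) = A_d(x) − ρ_q(d)/d · (x + 1)`. -/
def remQ (q : Polynomial ℤ) (x d : ℕ) : ℝ :=
  (congrQ q x d : ℝ) - (rhoQ q d : ℝ) / d * ((x : ℝ) + 1)

/-- The detector's sifting limit `z_q(x) = (|lead q| + 2)·x^{2/3}`: for `x` large and `n ≤ x`, `0 < q(n) < z_q(x)³`,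
so `q(n)` free of primes `< z_q(x)` has `Ω(q(n)) ≤ 2`. -/
def zDet (q : Polynomial ℤ) (x : ℕ) : ℝ :=
  ((q.leadingCoeff.natAbs : ℝ) + 2) * (x : ℝ) ^ ((2 : ℝ) / 3)

/-- Iwaniec's bilinear remainder form at shapes `M, N` with coefficient tables `a, b`, restricted to `mn ∣ P(z_q(x))`
(the form of the remainder in `Iwaniec1978.lemma2_bilinearSieve`). -/
def bilRem (q : Polynomial ℤ) (x : ℕ) (M N : ℝ) (a b : ℕ → ℝ) : ℝ :=
  ∑ m ∈ Finset.Ico 1 ⌈M⌉₊, ∑ n ∈ Finset.Ico 1 ⌈N⌉₊,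
    if m * n ∣ primesProdBelow (zDet q x) then a m * b n * remQ q x (m * n) else 0

/-- `HasBilinearLevel q ϑ`: BILINEAR level of distribution `x^ϑ` for `{q(n) : n ≤ x}` — for every `ε > 0` there are
shapes `M(x), N(x) > 1`, `x^ϑ ≤ M(x)N(x) ≤ x²`, such that every `1`-bounded bilinear remainder form is eventually
`≤ ε·x/log x` in absolute value. -/
def HasBilinearLevel (q : Polynomial ℤ) (ϑ : ℝ) : Prop :=
  ∀ ε : ℝ, 0 < ε → ∃ M N : ℕ → ℝ,
    (∀ᶠ x : ℕ in atTop, 1 < M x ∧ 1 < N x ∧ (x : ℝ) ^ ϑ ≤ M x * N x ∧ M x * N x ≤ (x : ℝ) ^ (2 : ℝ)) ∧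
    ∀ a b : ℕ → ℕ → ℝ, (∀ x m, |a x m| ≤ 1) → (∀ x n, |b x n| ≤ 1) →
      ∀ᶠ x : ℕ in atTop, |bilRem q x (M x) (N x) (a x) (b x)| ≤ ε * (x : ℝ) / Real.log (x : ℝ)

/-- The instrument: the unweighted detector's constant `θ₂(ϑ) = 4·log(3ϑ/2 − 1)/ϑ` at bilinear level `ϑ`. -/
def theta2 (ϑ : ℝ) : ℝ := 4 * Real.log (3 * ϑ / 2 - 1) / ϑ

/-! ### The two registered stubs -/

/-- Stub statement (LEVEL, IDEA-NEEDED): every quadratic Bateman–Horn polynomial has bilinear level `x^{7/4}`. -/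
def Signature.stub_bilinearLevel74 : Prop :=
  ∀ q : Polynomial ℤ, IsBatemanHornSystem ![q] → q.natDegree = 2 → HasBilinearLevel q (7 / 4)

/-- **LEVEL stub** (IDEA-NEEDED; open beyond `≈ 1.28`): bilinear level `7/4` for every quadratic BH polynomial. -/
theorem stub_bilinearLevel74 :
    ∀ q : Polynomial ℤ, IsBatemanHornSystem ![q] → q.natDegree = 2 → HasBilinearLevel q (7 / 4) := by
  sorry

example : Signature.stub_bilinearLevel74 := stub_bilinearLevel74

/-- Stub statement (SIEVE, print-grade): bilinear level `ϑ ∈ [4/3, 2]` ⇒ `P₂` with constant `θ₂(ϑ)`. -/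
def Signature.stub_sieveDetector : Prop :=
  ∀ q : Polynomial ℤ, IsBatemanHornSystem ![q] → q.natDegree = 2 →
    ∀ ϑ : ℝ, 4 / 3 ≤ ϑ → ϑ ≤ 2 → HasBilinearLevel q ϑ →
      ∀ ε : ℝ, 0 < ε → ∀ᶠ x : ℕ in Filter.atTop,
        (theta2 ϑ - ε) * (batemanHornConst ![q] / 2 * (x : ℝ) / Real.log x) ≤
          (((Finset.range (x + 1)).filter fun n : ℕ =>
              1 < q.eval (n : ℤ) ∧ ArithmeticFunction.cardFactors ((q.eval (n : ℤ)).toNat) ≤ 2).card : ℝ)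

/-- **SIEVE stub** (print-grade, L): Iwaniec's bilinear linear sieve (tree, PROVED) + Mertens for `ρ_q` (tree) + the
cube-root detector `z_q(x)`, giving the `P₂` count with constant `θ₂(ϑ) = 4 log(3ϑ/2 − 1)/ϑ` of `C(q)/2·x/log x`. -/
theorem stub_sieveDetector :
    ∀ q : Polynomial ℤ, IsBatemanHornSystem ![q] → q.natDegree = 2 →
      ∀ ϑ : ℝ, 4 / 3 ≤ ϑ → ϑ ≤ 2 → HasBilinearLevel q ϑ →
        ∀ ε : ℝ, 0 < ε → ∀ᶠ x : ℕ in Filter.atTop,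
          (theta2 ϑ - ε) * (batemanHornConst ![q] / 2 * (x : ℝ) / Real.log x) ≤
            (((Finset.range (x + 1)).filter fun n : ℕ =>
                1 < q.eval (n : ℤ) ∧ ArithmeticFunction.cardFactors ((q.eval (n : ℤ)).toNat) ≤ 2).card : ℝ) := by
  sorry

example : Signature.stub_sieveDetector := stub_sieveDetector

/-! ### Proved glue: the instrument exceeds `1` at `ϑ = 7/4` -/

/-- `θ₂(7/4) = (16/7)·log(13/8) > 1` (from `log 2 > 0.6931471803` and `log(16/13) ≤ 3/13`). -/
theorem one_lt_theta2 : 1 < theta2 (7 / 4) := by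
  unfold theta2
  have h1 : (3 * (7 / 4 : ℝ) / 2 - 1) = 2 / (16 / 13) := by norm_num
  rw [h1, Real.log_div (by norm_num) (by norm_num)]
  have h2 : Real.log (16 / 13 : ℝ) ≤ 16 / 13 - 1 := Real.log_le_sub_one_of_pos (by norm_num)
  have h3 := Real.log_two_gt_d9
  rw [lt_div_iff₀ (by norm_num : (0 : ℝ) < 7 / 4)]
  linarith

/-! ### Composition (kernel-checked): the two stubs give the ROUTE crux BY NAME -/

theorem ChenQuad_of :
    Signature.stub_bilinearLevel74 → Signature.stub_sieveDetector →
      Summit.Parity.BatemanHorn.Theses.OneSidedDegreeLadder.ChenQuad := by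
  intro hL hS q hq hdeg ε hε
  have hθ : 1 < theta2 (7 / 4) := one_lt_theta2
  have h := hS q hq hdeg (7 / 4) (by norm_num) (by norm_num) (hL q hq hdeg) (theta2 (7 / 4) - (1 - ε)) (by linarith)
  have hrw : theta2 (7 / 4) - (theta2 (7 / 4) - (1 - ε)) = 1 - ε := by ring
  rw [hrw] at h
  exact h

/-- **The skeleton instantiated**: the crux BY NAME modulo the two registered stubs (carries exactly their `sorry`s). -/
theorem ChenQuad_of_stubs : Summit.Parity.BatemanHorn.Theses.OneSidedDegreeLadder.ChenQuad :=
  ChenQuad_of stub_bilinearLevel74 stub_sieveDetector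

/-! ### The item stmt-Parity-26565 is SHARED verbatim by three BatemanHorn routes (OneSidedDegreeLadder — the record,
OddParityLadder — the ledger's primary decl for the item, DegreeExcessLadder); the same composition concludes each
copy BY NAME (the three `def`s have the identical body, so this is definitional unfolding). -/

theorem ChenQuad_of_odd :
    Signature.stub_bilinearLevel74 → Signature.stub_sieveDetector →
      Summit.Parity.BatemanHorn.Theses.OddParityLadder.ChenQuad :=
  fun hL hS => ChenQuad_of hL hS

/-- The checker's canonical name: the PRIMARY decl of stmt-Parity-26565 modulo the two registered stubs. -/
theorem ChenQuad_proof : Summit.Parity.BatemanHorn.Theses.OddParityLadder.ChenQuad :=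
  ChenQuad_of_odd stub_bilinearLevel74 stub_sieveDetector

theorem ChenQuad_of_degreeExcess :
    Signature.stub_bilinearLevel74 → Signature.stub_sieveDetector →
      Summit.Parity.BatemanHorn.Theses.DegreeExcessLadder.ChenQuad :=
  fun hL hS => ChenQuad_of hL hS

theorem ChenQuad_proof_degreeExcess : Summit.Parity.BatemanHorn.Theses.DegreeExcessLadder.ChenQuad :=
  ChenQuad_of_degreeExcess stub_bilinearLevel74 stub_sieveDetector

end Summit.Parity.BatemanHorn.Cruxes.ChenQuad.Birth

end
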